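import Summits.QuantumFields.YangMills.Theorems.UnitScaleGibbsBlockPlaquetteLinearisationOnBoxEvent
import HarnessLib

/-!
# `GrossTransferStubLinTestWindows` — KNIT-E2 SPLIT FILE (W): THE SIZE AND WINDOW ARITHMETIC OF `main_estimate`
# (LINE 28 «GrossTransfer», `stub_linTest`; crux `UnitScaleTilt.HistoryTailL` stmt-QuantumFields-19936 ∕ `MeanDeviationL` stmt-QuantumFields-23083)

Cell `ym3-torus` (YM ladder rung R3 = continuum SU(2) Yang–Mills on the three-torus — a RUNG, NOT the Clay problem: not d = 4, not infinite volume,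
not a mass gap); width seat `ym-ust-19936-w2` (gen 16); helper `--supports stmt-QuantumFields-23083`.  THEOREMS ONLY (0 `def`, 0 `sorry`, default
heartbeats).  Pure arithmetic moved out of the package file (the gate's 400-line lint): the dressing box `R₀ ≤ (7L+2)L^j`, `R = (R₀+12)L^{3j}`,
`n = 6R+6`, the coupling window `x = γL^{−K} ≤ L^{−K}` in the `y`-letters `y¹⁶ = x`, `θ = x^{3∕8} = y⁶`, and ✓P-LOC's two windows at `d = 3`.

* §1 SIZES (`ℕ`): `radius_le` (`R₀ ≤ (7L+2)·L^j`, ✓`sum_pow_lt_le`), `side_le` (`6R + 6 ≤ (42L+96)·L^{4j}`), `diam_le` (`6R + 1 ≤ (42L+85)·L^{4j}`).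
* §2 THE COUPLING WINDOW: `winNat` (`L^a·x^b ≤ 1` for `a ≤ K·b` when `0 ≤ x ≤ L^{−K}`, `1 ≤ L`), `exists_sixteenth_root` (the `y`-letters),
  `pow_mul_y6_le_one` (`L^a·y⁶ ≤ 1` for `8a ≤ 3K`), `pow_mul_y8_le_one` (`L^a·y⁸ ≤ 1` for `2a ≤ K`).
* §3 ✓P-LOC's LETTERS AT `d = 3`: `M_le_pow` (`M(L) ≤ L¹⁹`), `C1_le_pow` (`C₁(L) ≤ L¹⁹`), `D_le_pow` (`M² + C₂(L) ≤ L³⁹`), `one_add_mul_le_pow`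
  (`1 + 2n ≤ L^{4j+9}` from `n ≤ (42L+96)L^{4j}`), ★`ploc_window`∕★`ploc_window_delta` (the two windows `hwin`∕`hwinδ` from `L^{23j+9}y⁶ ≤ 1` ∕ `L^{23j+18}y⁶ ≤ 1`),
  `eta_le_one` (`(d−1)nθ ≤ 1` from `hwin`), `four_eta_le_one` (`4(d−1)nθ ≤ 1` from `L^{23j+15}y⁶ ≤ 1`), `rem_le` (✓P-LOC's remainder
  `C₁(L)·D(L)^j·((1+2n)θ)² ≤ L¹⁹·L^{47j+18}·θ²`, the amplitude shape of ✓`sq_le_of_window`).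

HONEST SCOPE.  Arithmetic only; NOTHING of `main_estimate`, `stub_linTest`, 23083∕23133∕23134, `HistoryTailL` (19936), the rung R3, d = 4, a continuum limit
or a mass gap is proved here; the Yang–Mills mass gap is NOT proved.
References: T. Bałaban, CMP 102 (1985) 255–275, (1)–(3) p. 256 [Balaban1985UV3]; CMP 98 (1985) 17–51, Prop. 1 (51) [Balaban1985Averaging];
L. Gross, CMP 92 (1983) 137–162, Thm 2.2 [GrossCMP1983].
-/

noncomputable section

set_option autoImplicit false

open scoped BigOperators
open Finset
open Literature.MathematicalPhysics.QuantumFieldTheory.Balaban1983to89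
open Literature.MathematicalPhysics.QuantumFieldTheory.Balaban1983to89.ExpMeanLog (deltaSU)
open Summit.QuantumFields.YangMills.Theorems.UnitScaleGibbsBlockPlaquetteLinearisationOnBoxEvent (sum_pow_lt_le)

namespace Summit.QuantumFields.YangMills.Theorems.GrossTransferStubLinTestWindows

/-! ## §1 Sizes -/

/-- `R₀ = ((d+4)L+2)·Σ_{k<j}L^k ≤ (7L+2)·L^j` at `d = 3` (✓`sum_pow_lt_le`). [cite: Balaban1985UV3, (1)-(3) p.256] -/
theorem radius_le (P : Params) (hd : P.d = 3) (j : ℕ) :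
    ((P.d + 4) * P.L + 2) * ∑ k ∈ Finset.range j, P.L ^ k ≤ (7 * P.L + 2) * P.L ^ j := by
  have h := sum_pow_lt_le (P := P) j
  have hd3 : (P.d + 4) * P.L + 2 = 7 * P.L + 2 := by rw [hd]
  calc ((P.d + 4) * P.L + 2) * ∑ k ∈ Finset.range j, P.L ^ k ≤ ((P.d + 4) * P.L + 2) * P.L ^ j := Nat.mul_le_mul_left _ h
    _ = (7 * P.L + 2) * P.L ^ j := by rw [hd3]

/-- THE BOX SIDE: with `R₀ ≤ (7L+2)L^j`, `n = 6·((R₀+12)L^{3j}) + 6 ≤ (42L+96)·L^{4j}` (`L ≥ 2`). [cite: Balaban1985UV3, (1)-(3) p.256] -/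
theorem side_le {L j R₀ : ℕ} (hL : 2 ≤ L) (hR₀ : R₀ ≤ (7 * L + 2) * L ^ j) :
    6 * ((R₀ + 12) * L ^ (3 * j)) + 6 ≤ (42 * L + 96) * L ^ (4 * j) := by
  have hLj : 1 ≤ L ^ j := Nat.one_le_pow _ _ (le_trans (by norm_num) hL)
  have e : L ^ (4 * j) = L ^ j * L ^ (3 * j) := by rw [← pow_add]; congr 1; ring
  rw [e]
  have h1 : R₀ + 12 ≤ (7 * L + 14) * L ^ j := by
    calc R₀ + 12 ≤ (7 * L + 2) * L ^ j + 12 * L ^ j := Nat.add_le_add hR₀ (by simpa using Nat.mul_le_mul_left 12 hLj)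
      _ = (7 * L + 14) * L ^ j := by ring
  have hP1 : 1 ≤ L ^ j * L ^ (3 * j) := Nat.one_le_iff_ne_zero.mpr (by positivity)
  calc 6 * ((R₀ + 12) * L ^ (3 * j)) + 6 ≤ 6 * (((7 * L + 14) * L ^ j) * L ^ (3 * j)) + 6 * (L ^ j * L ^ (3 * j)) :=
        Nat.add_le_add (Nat.mul_le_mul_left _ (Nat.mul_le_mul_right _ h1)) (by simpa using Nat.mul_le_mul_left 6 hP1)
    _ = (42 * L + 90) * (L ^ j * L ^ (3 * j)) := by ring
    _ ≤ (42 * L + 96) * (L ^ j * L ^ (3 * j)) := Nat.mul_le_mul_right _ (by omega)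

/-- THE BOX DIAMETER: `6·((R₀+12)L^{3j}) + 1 ≤ (42L+85)·L^{4j}` (the side count `2·3R + 1` of `Q_{3R}`). [cite: Balaban1985UV3, (1)-(3) p.256] -/
theorem diam_le {L j R₀ : ℕ} (hL : 2 ≤ L) (hR₀ : R₀ ≤ (7 * L + 2) * L ^ j) :
    6 * ((R₀ + 12) * L ^ (3 * j)) + 1 ≤ (42 * L + 85) * L ^ (4 * j) := by
  have hLj : 1 ≤ L ^ j := Nat.one_le_pow _ _ (le_trans (by norm_num) hL)
  have e : L ^ (4 * j) = L ^ j * L ^ (3 * j) := by rw [← pow_add]; congr 1; ring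
  rw [e]
  have h1 : R₀ + 12 ≤ (7 * L + 14) * L ^ j := by
    calc R₀ + 12 ≤ (7 * L + 2) * L ^ j + 12 * L ^ j := Nat.add_le_add hR₀ (by simpa using Nat.mul_le_mul_left 12 hLj)
      _ = (7 * L + 14) * L ^ j := by ring
  have hP1 : 1 ≤ L ^ j * L ^ (3 * j) := Nat.one_le_iff_ne_zero.mpr (by positivity)
  calc 6 * ((R₀ + 12) * L ^ (3 * j)) + 1 ≤ 6 * (((7 * L + 14) * L ^ j) * L ^ (3 * j)) + 1 * (L ^ j * L ^ (3 * j)) :=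
        Nat.add_le_add (Nat.mul_le_mul_left _ (Nat.mul_le_mul_right _ h1)) (by simpa using hP1)
    _ = (42 * L + 85) * (L ^ j * L ^ (3 * j)) := by ring

/-! ## §2 The coupling window in the `y`-letters -/

/-- **THE COUPLING WINDOW**: `1 ≤ L`, `0 ≤ x ≤ L^{−K}` ⇒ `L^a·x^b ≤ 1` whenever `a ≤ K·b`. [cite: GrossCMP1983, Thm 2.2] -/
theorem winNat {L x : ℝ} {K : ℕ} (hL : 1 ≤ L) (hx0 : 0 ≤ x) (hx : x ≤ (L⁻¹) ^ K) (a b : ℕ) (hab : a ≤ K * b) :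
    L ^ a * x ^ b ≤ 1 := by
  have hL0 : 0 < L := lt_of_lt_of_le zero_lt_one hL
  calc L ^ a * x ^ b ≤ L ^ a * ((L⁻¹) ^ K) ^ b := by gcongr
    _ = L ^ a / L ^ (K * b) := by rw [← pow_mul, inv_pow, div_eq_mul_inv]
    _ ≤ 1 := by rw [div_le_one (by positivity)]; exact pow_le_pow_right₀ hL hab

/-- **THE `y`-LETTERS**: for `0 < x` and `θ = x^{3∕8}` there is `y > 0` with `y¹⁶ = x` and `θ = y⁶`. [folklore] -/
theorem exists_sixteenth_root {x θ : ℝ} (hx : 0 < x) (hθ : θ = x ^ ((3 : ℝ) / 8)) : ∃ y : ℝ, 0 < y ∧ y ^ 16 = x ∧ θ = y ^ 6 := by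
  refine ⟨x ^ ((1 : ℝ) / 16), Real.rpow_pos_of_pos hx _, ?_, ?_⟩
  · rw [← Real.rpow_natCast _ 16, ← Real.rpow_mul hx.le]; norm_num
  · rw [hθ, ← Real.rpow_natCast _ 6, ← Real.rpow_mul hx.le]; norm_num

/-- `L^a·y⁶ ≤ 1` whenever `8a ≤ 3K` (`(L^a y⁶)⁸ = L^{8a}·x³`). [cite: GrossCMP1983, Thm 2.2] -/
theorem pow_mul_y6_le_one {L x y : ℝ} {K : ℕ} (hL : 1 ≤ L) (hy : 0 < y) (hy16 : y ^ 16 = x)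
    (hwin : ∀ a b : ℕ, a ≤ K * b → L ^ a * x ^ b ≤ 1) (a : ℕ) (ha : 8 * a ≤ 3 * K) : L ^ a * y ^ 6 ≤ 1 := by
  have hz0 : 0 ≤ L ^ a * y ^ 6 := mul_nonneg (pow_nonneg (zero_le_one.trans hL) _) (pow_nonneg hy.le 6)
  rw [← pow_le_one_iff_of_nonneg hz0 (by norm_num : (8 : ℕ) ≠ 0), mul_pow, ← pow_mul, ← pow_mul,
    show 6 * 8 = 16 * 3 by norm_num, pow_mul y 16 3, hy16]
  exact hwin _ _ (by omega)

/-- `L^a·y⁸ ≤ 1` whenever `2a ≤ K` (`(L^a y⁸)² = L^{2a}·x`). [cite: GrossCMP1983, Thm 2.2] -/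
theorem pow_mul_y8_le_one {L x y : ℝ} {K : ℕ} (hL : 1 ≤ L) (hy : 0 < y) (hy16 : y ^ 16 = x)
    (hwin : ∀ a b : ℕ, a ≤ K * b → L ^ a * x ^ b ≤ 1) (a : ℕ) (ha : 2 * a ≤ K) : L ^ a * y ^ 8 ≤ 1 := by
  have hz0 : 0 ≤ L ^ a * y ^ 8 := mul_nonneg (pow_nonneg (zero_le_one.trans hL) _) (pow_nonneg hy.le 8)
  rw [← pow_le_one_iff_of_nonneg hz0 (by norm_num : (2 : ℕ) ≠ 0), mul_pow, ← pow_mul, ← pow_mul,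
    show (8 * 2 : ℕ) = 16 by norm_num, hy16]
  have h := hwin (a * 2) 1 (by omega)
  rwa [pow_one] at h

/-! ## §3 ✓P-LOC's letters at `d = 3` -/

/-- `M(L) = L² + 143((7L)²∕4)² + 6((5L)²∕4) + L ≤ L¹⁹` (`L ≥ 2`). [cite: Balaban1985Averaging, Prop. 1 (51) pp.25-26] -/
theorem M_le_pow (P : Params) (hd : P.d = 3) (L : ℝ) (hPL : (P.L : ℝ) = L) :
    (P.L : ℝ) ^ 2 + 143 * ((((P.d + 4) * P.L : ℕ) : ℝ) ^ 2 / 4) ^ 2 + 6 * ((((P.d + 2) * P.L : ℕ) : ℝ) ^ 2 / 4) + P.L ≤ L ^ 19 := by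
  have hL2r : (2 : ℝ) ≤ L := by rw [← hPL]; exact_mod_cast P.hL.2
  have hL1 : (1 : ℝ) ≤ L := le_trans (by norm_num) hL2r
  rw [hd]; push_cast; rw [hPL]
  have h15 : (21499 : ℝ) ≤ L ^ 15 := le_trans (by norm_num) (pow_le_pow_left₀ (by norm_num) hL2r 15)
  have hL4 : (0 : ℝ) ≤ L ^ 4 := by positivity
  have hLle : L ≤ L ^ 4 := by
    calc L = L ^ 1 := (pow_one _).symm
      _ ≤ L ^ 4 := pow_le_pow_right₀ hL1 (by norm_num)
  have hL2le : L ^ 2 ≤ L ^ 4 := pow_le_pow_right₀ hL1 (by norm_num)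
  calc L ^ 2 + 143 * ((7 * L) ^ 2 / 4) ^ 2 + 6 * ((5 * L) ^ 2 / 4) + L
      = (143 * 2401 / 16) * L ^ 4 + (77 / 2) * L ^ 2 + L := by ring
    _ ≤ 21499 * L ^ 4 := by linarith only [hLle, hL2le, hL4]
    _ ≤ L ^ 15 * L ^ 4 := mul_le_mul_of_nonneg_right h15 hL4
    _ = L ^ 19 := by rw [← pow_add]

/-- ✓P-LOC's constant `C₁(L) = 143((7L)²∕4)² + L⁴ + 2(7L)L² ≤ L¹⁹` (`L ≥ 2`). [cite: Balaban1985Averaging, Prop. 1 (51) pp.25-26] -/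
theorem C1_le_pow (P : Params) (hd : P.d = 3) (L : ℝ) (hPL : (P.L : ℝ) = L) :
    143 * ((((P.d + 4) * P.L : ℕ) : ℝ) ^ 2 / 4) ^ 2 + (P.L : ℝ) ^ 4 + 2 * (((P.d + 4) * P.L : ℕ) : ℝ) * (P.L : ℝ) ^ 2 ≤ L ^ 19 := by
  have hL2r : (2 : ℝ) ≤ L := by rw [← hPL]; exact_mod_cast P.hL.2
  have hL1 : (1 : ℝ) ≤ L := le_trans (by norm_num) hL2r
  rw [hd]; push_cast; rw [hPL]
  have h15 : (21475 : ℝ) ≤ L ^ 15 := le_trans (by norm_num) (pow_le_pow_left₀ (by norm_num) hL2r 15)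
  have hL4 : (0 : ℝ) ≤ L ^ 4 := by positivity
  have hL3le : L ^ 3 ≤ L ^ 4 := pow_le_pow_right₀ hL1 (by norm_num)
  calc 143 * ((7 * L) ^ 2 / 4) ^ 2 + L ^ 4 + 2 * (7 * L) * L ^ 2
      = (143 * 2401 / 16 + 1) * L ^ 4 + 14 * L ^ 3 := by ring
    _ ≤ 21475 * L ^ 4 := by linarith only [hL3le, hL4]
    _ ≤ L ^ 15 * L ^ 4 := mul_le_mul_of_nonneg_right h15 hL4
    _ = L ^ 19 := by rw [← pow_add]

/-- ✓P-LOC's base `D(L) = M(L)² + (L² + 2(7L)L²) ≤ L³⁹` (`L ≥ 2`). [cite: Balaban1985Averaging, Prop. 1 (51) pp.25-26] -/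
theorem D_le_pow (P : Params) (hd : P.d = 3) (L : ℝ) (hPL : (P.L : ℝ) = L) :
    ((P.L : ℝ) ^ 2 + 143 * ((((P.d + 4) * P.L : ℕ) : ℝ) ^ 2 / 4) ^ 2 + 6 * ((((P.d + 2) * P.L : ℕ) : ℝ) ^ 2 / 4) + P.L) ^ 2 +
        ((P.L : ℝ) ^ 2 + 2 * (((P.d + 4) * P.L : ℕ) : ℝ) * (P.L : ℝ) ^ 2) ≤ L ^ 39 := by
  have hM := M_le_pow P hd L hPL
  have hL2r : (2 : ℝ) ≤ L := by rw [← hPL]; exact_mod_cast P.hL.2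
  have hL1 : (1 : ℝ) ≤ L := le_trans (by norm_num) hL2r
  have hM0 : (0 : ℝ) ≤ (P.L : ℝ) ^ 2 + 143 * ((((P.d + 4) * P.L : ℕ) : ℝ) ^ 2 / 4) ^ 2 + 6 * ((((P.d + 2) * P.L : ℕ) : ℝ) ^ 2 / 4) + P.L := by
    positivity
  have hM2 : ((P.L : ℝ) ^ 2 + 143 * ((((P.d + 4) * P.L : ℕ) : ℝ) ^ 2 / 4) ^ 2 + 6 * ((((P.d + 2) * P.L : ℕ) : ℝ) ^ 2 / 4) + P.L) ^ 2 ≤ (L ^ 19) ^ 2 :=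
    pow_le_pow_left₀ hM0 hM 2
  have hC2 : (P.L : ℝ) ^ 2 + 2 * (((P.d + 4) * P.L : ℕ) : ℝ) * (P.L : ℝ) ^ 2 ≤ L ^ 38 := by
    rw [hd]; push_cast; rw [hPL]
    have h35 : (15 : ℝ) ≤ L ^ 35 := le_trans (by norm_num) (pow_le_pow_left₀ (by norm_num) hL2r 35)
    have hL3 : (0 : ℝ) ≤ L ^ 3 := by positivity
    have hL23 : L ^ 2 ≤ L ^ 3 := pow_le_pow_right₀ hL1 (by norm_num)
    calc L ^ 2 + 2 * (7 * L) * L ^ 2 = L ^ 2 + 14 * L ^ 3 := by ring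
      _ ≤ 15 * L ^ 3 := by linarith only [hL23]
      _ ≤ L ^ 35 * L ^ 3 := mul_le_mul_of_nonneg_right h35 hL3
      _ = L ^ 38 := by rw [← pow_add]
  have h38 : L ^ 38 ≤ L ^ 38 * (L - 1) := by
    have h0 : (0 : ℝ) ≤ L ^ 38 := by positivity
    nlinarith only [h0, hL2r]
  calc _ ≤ (L ^ 19) ^ 2 + L ^ 38 := add_le_add hM2 hC2
    _ = L ^ 38 + L ^ 38 := by rw [← pow_mul]
    _ ≤ L ^ 38 + L ^ 38 * (L - 1) := by linarith only [h38]
    _ = L ^ 39 := by ring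

/-- `1 + (d−1)·n ≤ L^{4j+9}` at `d = 3` when `n ≤ (42L+96)·L^{4j}` (`L ≥ 2`: `84L + 193 ≤ L⁹`). [cite: Balaban1985UV3, (1)-(3) p.256] -/
theorem one_add_mul_le_pow (P : Params) (hd : P.d = 3) (L : ℝ) (hPL : (P.L : ℝ) = L) {n j : ℕ}
    (hn : (n : ℝ) ≤ (42 * L + 96) * L ^ (4 * j)) :
    1 + ((P.d - 1 : ℕ) : ℝ) * n ≤ L ^ (4 * j + 9) := by
  have hL2r : (2 : ℝ) ≤ L := by rw [← hPL]; exact_mod_cast P.hL.2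
  have hL1 : (1 : ℝ) ≤ L := le_trans (by norm_num) hL2r
  rw [hd]; push_cast
  have h9 : (84 * L + 193) ≤ L ^ 9 := by
    have h8 : (256 : ℝ) ≤ L ^ 8 := le_trans (by norm_num) (pow_le_pow_left₀ (by norm_num) hL2r 8)
    calc (84 * L + 193) ≤ 256 * L := by linarith only [hL2r]
      _ ≤ L ^ 8 * L := mul_le_mul_of_nonneg_right h8 (by linarith)
      _ = L ^ 9 := by ring
  have hL4j : (1 : ℝ) ≤ L ^ (4 * j) := one_le_pow₀ hL1
  have hL4j0 : (0 : ℝ) ≤ L ^ (4 * j) := by positivity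
  have e193 : (84 * L + 193) * L ^ (4 * j) = 2 * ((42 * L + 96) * L ^ (4 * j)) + L ^ (4 * j) := by ring
  calc 1 + (2 : ℝ) * n ≤ 1 + 2 * ((42 * L + 96) * L ^ (4 * j)) := by linarith only [hn]
    _ ≤ (84 * L + 193) * L ^ (4 * j) := by rw [e193]; linarith only [hL4j]
    _ ≤ L ^ 9 * L ^ (4 * j) := mul_le_mul_of_nonneg_right h9 hL4j0
    _ = L ^ (4 * j + 9) := by rw [← pow_add]; ring_nf

/-- ★ **✓P-LOC's FIRST WINDOW `M^j·(1+(d−1)n)·θ ≤ 1` AT `d = 3`** from `n ≤ (42L+96)L^{4j}`, `θ = y⁶` and `L^{23j+9}·y⁶ ≤ 1`.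
[cite: Balaban1985Averaging, Prop. 1 (51) pp.25-26] -/
theorem ploc_window (P : Params) (hd : P.d = 3) (L : ℝ) (hPL : (P.L : ℝ) = L) {n j : ℕ} {θ y : ℝ}
    (hn : (n : ℝ) ≤ (42 * L + 96) * L ^ (4 * j)) (hθ : θ = y ^ 6) (hy : 0 ≤ y) (hcore : L ^ (23 * j + 9) * y ^ 6 ≤ 1) :
    ((P.L : ℝ) ^ 2 + 143 * ((((P.d + 4) * P.L : ℕ) : ℝ) ^ 2 / 4) ^ 2 + 6 * ((((P.d + 2) * P.L : ℕ) : ℝ) ^ 2 / 4) + P.L) ^ j *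
        ((1 + ((P.d - 1 : ℕ) : ℝ) * n) * θ) ≤ 1 := by
  have hL2r : (2 : ℝ) ≤ L := by rw [← hPL]; exact_mod_cast P.hL.2
  have hL1 : (1 : ℝ) ≤ L := le_trans (by norm_num) hL2r
  have hM := M_le_pow P hd L hPL
  have hN1 := one_add_mul_le_pow P hd L hPL hn
  have hM0 : (0 : ℝ) ≤ (P.L : ℝ) ^ 2 + 143 * ((((P.d + 4) * P.L : ℕ) : ℝ) ^ 2 / 4) ^ 2 + 6 * ((((P.d + 2) * P.L : ℕ) : ℝ) ^ 2 / 4) + P.L := by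
    positivity
  have h1 := pow_le_pow_left₀ hM0 hM j
  have hn0 : (0 : ℝ) ≤ 1 + ((P.d - 1 : ℕ) : ℝ) * n := by positivity
  have hy6 : 0 ≤ y ^ 6 := pow_nonneg hy 6
  rw [hθ]
  calc _ ≤ (L ^ 19) ^ j * (L ^ (4 * j + 9) * y ^ 6) :=
        mul_le_mul h1 (mul_le_mul_of_nonneg_right hN1 hy6) (mul_nonneg hn0 hy6) (by positivity)
    _ = L ^ (23 * j + 9) * y ^ 6 := by rw [← pow_mul, ← mul_assoc, ← pow_add]; ring_nf
    _ ≤ 1 := hcore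

/-- ★ **✓P-LOC's SECOND WINDOW `(((d+4)L)²∕4)·M^j·(1+(d−1)n)·θ ≤ δ_{SU(2)}∕2 = 1∕6` AT `d = 3`** from `n ≤ (42L+96)L^{4j}`, `θ = y⁶` and
`L^{23j+18}·y⁶ ≤ 1` (`(7L)²∕4 ≤ L⁶`, `8 ≤ L³`, `6 ≤ 8`). [cite: Balaban1985Averaging, Prop. 1 (51) pp.25-26] -/
theorem ploc_window_delta (P : Params) (hd : P.d = 3) (L : ℝ) (hPL : (P.L : ℝ) = L) {n j : ℕ} {θ y : ℝ}
    (hn : (n : ℝ) ≤ (42 * L + 96) * L ^ (4 * j)) (hθ : θ = y ^ 6) (hy : 0 ≤ y) (hcore : L ^ (23 * j + 18) * y ^ 6 ≤ 1) :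
    ((((P.d + 4) * P.L : ℕ) : ℝ) ^ 2 / 4) *
        (((P.L : ℝ) ^ 2 + 143 * ((((P.d + 4) * P.L : ℕ) : ℝ) ^ 2 / 4) ^ 2 + 6 * ((((P.d + 2) * P.L : ℕ) : ℝ) ^ 2 / 4) + P.L) ^ j *
          ((1 + ((P.d - 1 : ℕ) : ℝ) * n) * θ)) ≤ deltaSU (Fin 2) / 2 := by
  have hL2r : (2 : ℝ) ≤ L := by rw [← hPL]; exact_mod_cast P.hL.2
  have hL1 : (1 : ℝ) ≤ L := le_trans (by norm_num) hL2r
  have hM := M_le_pow P hd L hPL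
  have hN1 := one_add_mul_le_pow P hd L hPL hn
  have hδ : deltaSU (Fin 2) = 1 / 3 := by
    rw [ExpMeanLog.deltaSU, Fintype.card_fin]
    exact min_eq_left (by have := Real.pi_gt_three; push_cast; linarith)
  have hM0 : (0 : ℝ) ≤ (P.L : ℝ) ^ 2 + 143 * ((((P.d + 4) * P.L : ℕ) : ℝ) ^ 2 / 4) ^ 2 + 6 * ((((P.d + 2) * P.L : ℕ) : ℝ) ^ 2 / 4) + P.L := by
    positivity
  have h6 : ((((P.d + 4) * P.L : ℕ) : ℝ) ^ 2 / 4) ≤ L ^ 6 := by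
    rw [hd]; push_cast; rw [hPL]
    have h4 : (16 : ℝ) ≤ L ^ 4 := le_trans (by norm_num) (pow_le_pow_left₀ (by norm_num) hL2r 4)
    have hL2 : (0 : ℝ) ≤ L ^ 2 := by positivity
    calc ((7 : ℝ) * L) ^ 2 / 4 = (49 / 4) * L ^ 2 := by ring
      _ ≤ 16 * L ^ 2 := by linarith only [hL2]
      _ ≤ L ^ 4 * L ^ 2 := mul_le_mul_of_nonneg_right h4 hL2
      _ = L ^ 6 := by rw [← pow_add]
  have hy6 : 0 ≤ y ^ 6 := pow_nonneg hy 6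
  have hn0 : (0 : ℝ) ≤ 1 + ((P.d - 1 : ℕ) : ℝ) * n := by positivity
  have hprodθ : ((P.L : ℝ) ^ 2 + 143 * ((((P.d + 4) * P.L : ℕ) : ℝ) ^ 2 / 4) ^ 2 + 6 * ((((P.d + 2) * P.L : ℕ) : ℝ) ^ 2 / 4) + P.L) ^ j *
      ((1 + ((P.d - 1 : ℕ) : ℝ) * n) * θ) ≤ L ^ (23 * j + 9) * y ^ 6 := by
    have h1 := pow_le_pow_left₀ hM0 hM j
    rw [hθ]
    calc _ ≤ (L ^ 19) ^ j * (L ^ (4 * j + 9) * y ^ 6) :=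
          mul_le_mul h1 (mul_le_mul_of_nonneg_right hN1 hy6) (mul_nonneg hn0 hy6) (by positivity)
      _ = L ^ (23 * j + 9) * y ^ 6 := by rw [← pow_mul, ← mul_assoc, ← pow_add]; ring_nf
  have hprod0 : 0 ≤ ((P.L : ℝ) ^ 2 + 143 * ((((P.d + 4) * P.L : ℕ) : ℝ) ^ 2 / 4) ^ 2 + 6 * ((((P.d + 2) * P.L : ℕ) : ℝ) ^ 2 / 4) + P.L) ^ j *
      ((1 + ((P.d - 1 : ℕ) : ℝ) * n) * θ) := mul_nonneg (pow_nonneg hM0 j) (mul_nonneg hn0 (by rw [hθ]; exact hy6))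
  have hL3 : L ^ (23 * j + 15) * y ^ 6 * 8 ≤ L ^ (23 * j + 18) * y ^ 6 := by
    have h3 : (8 : ℝ) ≤ L ^ 3 := le_trans (by norm_num) (pow_le_pow_left₀ (by norm_num) hL2r 3)
    have hA0 : 0 ≤ L ^ (23 * j + 15) * y ^ 6 := mul_nonneg (pow_nonneg (le_trans zero_le_one hL1) _) hy6
    calc L ^ (23 * j + 15) * y ^ 6 * 8 ≤ L ^ (23 * j + 15) * y ^ 6 * L ^ 3 := mul_le_mul_of_nonneg_left h3 hA0
      _ = L ^ (23 * j + 18) * y ^ 6 := by rw [show L ^ (23 * j + 18) = L ^ (23 * j + 15) * L ^ 3 by rw [← pow_add]]; ring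
  have hL6 : (0 : ℝ) ≤ L ^ 6 := by positivity
  have hstep : L ^ 6 * (L ^ (23 * j + 9) * y ^ 6) = L ^ (23 * j + 15) * y ^ 6 := by
    rw [← mul_assoc, ← pow_add, show 6 + (23 * j + 9) = 23 * j + 15 by ring]
  have hA15 : 0 ≤ L ^ (23 * j + 15) * y ^ 6 := mul_nonneg (pow_nonneg (le_trans zero_le_one hL1) _) hy6
  rw [hδ]
  calc _ ≤ L ^ 6 * (L ^ (23 * j + 9) * y ^ 6) := mul_le_mul h6 hprodθ hprod0 hL6
    _ = L ^ (23 * j + 15) * y ^ 6 := hstep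
    _ ≤ 1 / 8 := by linarith only [hcore, hL3, hA15]
    _ ≤ 1 / 3 / 2 := by norm_num

/-- `(d−1)·n·θ ≤ 1` from the first window (`1 ≤ M`). [cite: Balaban1985Averaging, Prop. 1 (51) pp.25-26] -/
theorem eta_le_one (P : Params) {n j : ℕ} {θ : ℝ} (hθ : 0 ≤ θ)
    (hwin : ((P.L : ℝ) ^ 2 + 143 * ((((P.d + 4) * P.L : ℕ) : ℝ) ^ 2 / 4) ^ 2 + 6 * ((((P.d + 2) * P.L : ℕ) : ℝ) ^ 2 / 4) + P.L) ^ j *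
        ((1 + ((P.d - 1 : ℕ) : ℝ) * n) * θ) ≤ 1) :
    ((P.d - 1 : ℕ) : ℝ) * n * θ ≤ 1 := by
  have hL1 : (1 : ℝ) ≤ (P.L : ℝ) := by exact_mod_cast (le_trans (by norm_num) P.hL.2 : 1 ≤ P.L)
  have hM1 : (1 : ℝ) ≤ (P.L : ℝ) ^ 2 + 143 * ((((P.d + 4) * P.L : ℕ) : ℝ) ^ 2 / 4) ^ 2 + 6 * ((((P.d + 2) * P.L : ℕ) : ℝ) ^ 2 / 4) + P.L := by
    have h2 : (0 : ℝ) ≤ (P.L : ℝ) ^ 2 + 143 * ((((P.d + 4) * P.L : ℕ) : ℝ) ^ 2 / 4) ^ 2 + 6 * ((((P.d + 2) * P.L : ℕ) : ℝ) ^ 2 / 4) := by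
      positivity
    linarith only [hL1, h2]
  have hMj1 : (1 : ℝ) ≤ ((P.L : ℝ) ^ 2 + 143 * ((((P.d + 4) * P.L : ℕ) : ℝ) ^ 2 / 4) ^ 2 + 6 * ((((P.d + 2) * P.L : ℕ) : ℝ) ^ 2 / 4) + P.L) ^ j :=
    one_le_pow₀ hM1
  have hn0 : (0 : ℝ) ≤ ((P.d - 1 : ℕ) : ℝ) * n * θ := by positivity
  have hA : ((P.d - 1 : ℕ) : ℝ) * n * θ ≤ (1 + ((P.d - 1 : ℕ) : ℝ) * n) * θ := by nlinarith only [hθ, hn0]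
  have h0 : (0 : ℝ) ≤ (1 + ((P.d - 1 : ℕ) : ℝ) * n) * θ := by positivity
  have hB : (1 + ((P.d - 1 : ℕ) : ℝ) * n) * θ ≤ ((P.L : ℝ) ^ 2 + 143 * ((((P.d + 4) * P.L : ℕ) : ℝ) ^ 2 / 4) ^ 2 +
      6 * ((((P.d + 2) * P.L : ℕ) : ℝ) ^ 2 / 4) + P.L) ^ j * ((1 + ((P.d - 1 : ℕ) : ℝ) * n) * θ) := by nlinarith only [hMj1, h0]
  linarith only [hA, hB, hwin]

/-- `4·(d−1)·n·θ ≤ 1` at `d = 3` from `n ≤ (42L+96)L^{4j}`, `θ = y⁶`, `8 ≤ L³` and `L^{23j+15}·y⁶ ≤ 1`. [cite: GrossCMP1983, Thm 2.2] -/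
theorem four_eta_le_one (P : Params) (hd : P.d = 3) (L : ℝ) (hPL : (P.L : ℝ) = L) {n j : ℕ} {θ y : ℝ}
    (hn : (n : ℝ) ≤ (42 * L + 96) * L ^ (4 * j)) (hθ : θ = y ^ 6) (hy : 0 ≤ y) (hcore : L ^ (23 * j + 15) * y ^ 6 ≤ 1) :
    4 * (((P.d - 1 : ℕ) : ℝ) * n * θ) ≤ 1 := by
  have hL2r : (2 : ℝ) ≤ L := by rw [← hPL]; exact_mod_cast P.hL.2
  have hL1 : (1 : ℝ) ≤ L := le_trans (by norm_num) hL2r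
  have hN1 := one_add_mul_le_pow P hd L hPL hn
  have h8 : (8 : ℝ) ≤ L ^ 3 := le_trans (by norm_num) (pow_le_pow_left₀ (by norm_num) hL2r 3)
  have hn0 : (0 : ℝ) ≤ ((P.d - 1 : ℕ) : ℝ) * n := by positivity
  have hn2 : ((P.d - 1 : ℕ) : ℝ) * n ≤ L ^ (4 * j + 9) := by linarith only [hN1, hn0]
  have hy6 : 0 ≤ y ^ 6 := pow_nonneg hy 6
  have hpow : L ^ 3 * L ^ (4 * j + 9) ≤ L ^ (23 * j + 15) := by
    rw [← pow_add]; exact pow_le_pow_right₀ hL1 (by omega)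
  have hAy : 0 ≤ ((P.d - 1 : ℕ) : ℝ) * n * y ^ 6 := mul_nonneg hn0 hy6
  rw [hθ]
  calc 4 * (((P.d - 1 : ℕ) : ℝ) * n * y ^ 6) ≤ 8 * (((P.d - 1 : ℕ) : ℝ) * n * y ^ 6) := by linarith only [hAy]
    _ ≤ L ^ 3 * (((P.d - 1 : ℕ) : ℝ) * n * y ^ 6) := mul_le_mul_of_nonneg_right h8 hAy
    _ = L ^ 3 * (((P.d - 1 : ℕ) : ℝ) * n) * y ^ 6 := by ring
    _ ≤ L ^ 3 * L ^ (4 * j + 9) * y ^ 6 := mul_le_mul_of_nonneg_right (mul_le_mul_of_nonneg_left hn2 (by positivity)) hy6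
    _ ≤ L ^ (23 * j + 15) * y ^ 6 := mul_le_mul_of_nonneg_right hpow hy6
    _ ≤ 1 := hcore

/-- ★ **✓P-LOC's REMAINDER AS A `θ²`-AMPLITUDE**: `C₁(L)·D(L)^j·((1+(d−1)n)θ)² ≤ L¹⁹·L^{47j+18}·θ²` at `d = 3` (`C₁ ≤ L¹⁹`, `D ≤ L³⁹`, `1+2n ≤ L^{4j+9}`) —
the shape `A ≤ c·L^a·θ²` of ✓`GrossTransferStubLinTestAssembly.sq_le_of_window` with `c = L¹⁹`, `a = 47j + 18`. [cite: GrossCMP1983, Thm 2.2] -/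
theorem rem_le (P : Params) (hd : P.d = 3) (L : ℝ) (hPL : (P.L : ℝ) = L) {n j : ℕ} {θ : ℝ}
    (hn : (n : ℝ) ≤ (42 * L + 96) * L ^ (4 * j)) :
    (143 * ((((P.d + 4) * P.L : ℕ) : ℝ) ^ 2 / 4) ^ 2 + (P.L : ℝ) ^ 4 + 2 * (((P.d + 4) * P.L : ℕ) : ℝ) * (P.L : ℝ) ^ 2) *
        (((P.L : ℝ) ^ 2 + 143 * ((((P.d + 4) * P.L : ℕ) : ℝ) ^ 2 / 4) ^ 2 + 6 * ((((P.d + 2) * P.L : ℕ) : ℝ) ^ 2 / 4) + P.L) ^ 2 +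
            ((P.L : ℝ) ^ 2 + 2 * (((P.d + 4) * P.L : ℕ) : ℝ) * (P.L : ℝ) ^ 2)) ^ j *
          ((1 + ((P.d - 1 : ℕ) : ℝ) * n) * θ) ^ 2
      ≤ L ^ 19 * L ^ (47 * j + 18) * θ ^ 2 := by
  have hL2r : (2 : ℝ) ≤ L := by rw [← hPL]; exact_mod_cast P.hL.2
  have hL1 : (1 : ℝ) ≤ L := le_trans (by norm_num) hL2r
  have hL0 : (0 : ℝ) ≤ L := le_trans zero_le_one hL1
  have hC1 := C1_le_pow P hd L hPL
  have hD := D_le_pow P hd L hPL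
  have hN1 := one_add_mul_le_pow P hd L hPL hn
  have hC10 : (0 : ℝ) ≤ 143 * ((((P.d + 4) * P.L : ℕ) : ℝ) ^ 2 / 4) ^ 2 + (P.L : ℝ) ^ 4 + 2 * (((P.d + 4) * P.L : ℕ) : ℝ) * (P.L : ℝ) ^ 2 := by
    positivity
  have hD0 : (0 : ℝ) ≤ ((P.L : ℝ) ^ 2 + 143 * ((((P.d + 4) * P.L : ℕ) : ℝ) ^ 2 / 4) ^ 2 + 6 * ((((P.d + 2) * P.L : ℕ) : ℝ) ^ 2 / 4) + P.L) ^ 2 +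
      ((P.L : ℝ) ^ 2 + 2 * (((P.d + 4) * P.L : ℕ) : ℝ) * (P.L : ℝ) ^ 2) := by positivity
  have hn0 : (0 : ℝ) ≤ 1 + ((P.d - 1 : ℕ) : ℝ) * n := by positivity
  have hDj : (((P.L : ℝ) ^ 2 + 143 * ((((P.d + 4) * P.L : ℕ) : ℝ) ^ 2 / 4) ^ 2 + 6 * ((((P.d + 2) * P.L : ℕ) : ℝ) ^ 2 / 4) + P.L) ^ 2 +
      ((P.L : ℝ) ^ 2 + 2 * (((P.d + 4) * P.L : ℕ) : ℝ) * (P.L : ℝ) ^ 2)) ^ j ≤ (L ^ 39) ^ j := pow_le_pow_left₀ hD0 hD j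
  have hN2 : ((1 + ((P.d - 1 : ℕ) : ℝ) * n) * θ) ^ 2 ≤ (L ^ (4 * j + 9)) ^ 2 * θ ^ 2 := by
    rw [mul_pow]
    exact mul_le_mul_of_nonneg_right (pow_le_pow_left₀ hn0 hN1 2) (sq_nonneg θ)
  have hθ2 : 0 ≤ θ ^ 2 := sq_nonneg θ
  calc _ ≤ L ^ 19 * (L ^ 39) ^ j * ((L ^ (4 * j + 9)) ^ 2 * θ ^ 2) :=
        mul_le_mul (mul_le_mul hC1 hDj (pow_nonneg hD0 j) (by positivity)) hN2 (by positivity) (by positivity)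
    _ = L ^ 19 * L ^ (47 * j + 18) * θ ^ 2 := by
        rw [← pow_mul, ← pow_mul, show L ^ 19 * L ^ (39 * j) * (L ^ ((4 * j + 9) * 2) * θ ^ 2) = L ^ 19 * (L ^ (39 * j) * L ^ ((4 * j + 9) * 2)) * θ ^ 2 by ring,
          ← pow_add, show 39 * j + (4 * j + 9) * 2 = 47 * j + 18 by ring]

end Summit.QuantumFields.YangMills.Theorems.GrossTransferStubLinTestWindows

end
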